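import Mathlib

/-!
# Imbrie2016 / CoverExchange — kernel anchors for DENSITY-XY ADDENDUM G″ (T5 = (U₄))

Audit lemmas only (repair cell 4, XY rung, tag b2b): the EXCHANGE INEQUALITIES (Lemma G.19)
at `n = 4` and the COVER LEMMA (G.20) for four weighted points on a line, stated about
explicit real polynomials.  Nothing in this file asserts LLA, Theorem 1.1 or any density bound;
the analytic part of Theorem G.21 (the vertex chart, Lemma G.18, Theorem 4.3) is NOT formalised
here.

Dictionary (DENSITY-XY G.17).  Four levels `x₁ … x₄ : ℝ` (no ordering or distinctness is
needed below) with weights `w ∈ Δ₃°`.  The pair terms `A_ij := w_i w_j (x_i - x_j)²` and the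
triple terms `C_m := (∏_{j ≠ m} w_j) · Δ(x_{-m})²` are the summands of `D₂(w)` and `D₃(w)`;
`out₂(m) = Σ_{ {i,j} ∌ m} A_ij`, `in₂(m) = Σ_{ {i,j} ∋ m} A_ij`, `out₃(m) = C_m`,
`in₃(m) = Σ_{j ≠ m} C_j`.

* `exchange_two`, `exchange_three` : (E1) at `n = 4`, `k = 2, 3`, for the level `x₄`
  (`out_k(4) ≤ (4-k)·((1-w₄)/w₄)·in_k(4)`, multiplied through by `w₄`; the other levels by
  relabelling).  `k = 3` goes through the Lagrange partial-fraction identity `lagrange_three`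
  and the cleared-denominator weighted Cauchy–Schwarz identity `weightedCS_three_eq`.
* `quadMin_eq`, `pair_lower` : (E3), the bound `P ≥ w_p w_q d_pq² / (w_p + w_q)` in the
  homogeneous form `(Σ w) · A_pq ≤ (w_p + w_q) · P`.
* `coverB_four_abstract`, `coverB_four` : the cover lemma in the SHARPER all-β form — for every
  `w ∈ Δ₃°` some level `m` has `w_m ≥ 1/10`, `out₂(m) ≤ 3 in₂(m)`, `out₃(m) ≤ 3 in₃(m)`
  (so the all-α pieces `A_m` of G.18 are not needed at `n = 4`; the constant of Thm G.21 may be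
  read as `4·16·10^{3/2}·U`).  `cover_four` is Lemma G.20 exactly as landed (B-or-A form).
The abstract version isolates what the case analysis uses: (E1) for each level, the six pair
bounds (E3), and nonnegativity; (E2) is built into the parametrisation by the `A_ij`, `C_m`.
-/

namespace Literature.MathematicalPhysics.QuantumLattice.Imbrie2016

/-! ## (E1), k = 2 -/

/-- (E1) at `n = 4`, `k = 2`, level `x₄`, times `w₄`-free form:
`out₂(4) ≤ 2 (w₁ + w₂ + w₃) · (in₂(4) / w₄)` (triangle inequality).
[cite: ImbrieJSP2016, §4.2.1]  [folklore] -/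
theorem exchange_two (x₁ x₂ x₃ x₄ w₁ w₂ w₃ : ℝ) (h₁ : 0 ≤ w₁) (h₂ : 0 ≤ w₂) (h₃ : 0 ≤ w₃) :
    w₁ * w₂ * (x₁ - x₂) ^ 2 + w₁ * w₃ * (x₁ - x₃) ^ 2 + w₂ * w₃ * (x₂ - x₃) ^ 2
      ≤ 2 * (w₁ + w₂ + w₃) *
          (w₁ * (x₁ - x₄) ^ 2 + w₂ * (x₂ - x₄) ^ 2 + w₃ * (x₃ - x₄) ^ 2) := by
  have t₁₂ : (x₁ - x₂) ^ 2 ≤ 2 * (x₁ - x₄) ^ 2 + 2 * (x₂ - x₄) ^ 2 := by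
    nlinarith [sq_nonneg (x₁ + x₂ - 2 * x₄)]
  have t₁₃ : (x₁ - x₃) ^ 2 ≤ 2 * (x₁ - x₄) ^ 2 + 2 * (x₃ - x₄) ^ 2 := by
    nlinarith [sq_nonneg (x₁ + x₃ - 2 * x₄)]
  have t₂₃ : (x₂ - x₃) ^ 2 ≤ 2 * (x₂ - x₄) ^ 2 + 2 * (x₃ - x₄) ^ 2 := by
    nlinarith [sq_nonneg (x₂ + x₃ - 2 * x₄)]
  have a₁₂ := mul_le_mul_of_nonneg_left t₁₂ (mul_nonneg h₁ h₂)
  have a₁₃ := mul_le_mul_of_nonneg_left t₁₃ (mul_nonneg h₁ h₃)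
  have a₂₃ := mul_le_mul_of_nonneg_left t₂₃ (mul_nonneg h₂ h₃)
  have s₁ := mul_nonneg (mul_nonneg h₁ h₁) (sq_nonneg (x₁ - x₄))
  have s₂ := mul_nonneg (mul_nonneg h₂ h₂) (sq_nonneg (x₂ - x₄))
  have s₃ := mul_nonneg (mul_nonneg h₃ h₃) (sq_nonneg (x₃ - x₄))
  nlinarith [a₁₂, a₁₃, a₂₃, s₁, s₂, s₃]

/-! ## (E1), k = 3: Lagrange exchange -/

/-- Lagrange partial fractions at the nodes `x₁, x₂, x₃`, evaluated at `x₄` and cleared of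
denominators: `V · (ℓ₁ + ℓ₂ + ℓ₃)(x₄) = V` with `V = Δ(x₁,x₂,x₃)`.  [folklore] -/
theorem lagrange_three (x₁ x₂ x₃ x₄ : ℝ) :
    (x₃ - x₂) * (x₄ - x₂) * (x₄ - x₃) - (x₃ - x₁) * (x₄ - x₁) * (x₄ - x₃)
        + (x₂ - x₁) * (x₄ - x₁) * (x₄ - x₂)
      = (x₂ - x₁) * (x₃ - x₁) * (x₃ - x₂) := by
  ring

/-- Weighted Cauchy–Schwarz with cleared denominators, three terms, as an identity.  [folklore] -/
theorem weightedCS_three_eq (l₁ l₂ l₃ w₁ w₂ w₃ : ℝ) :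
    (w₁ + w₂ + w₃) * (w₂ * w₃ * l₁ ^ 2 + w₁ * w₃ * l₂ ^ 2 + w₁ * w₂ * l₃ ^ 2)
        - w₁ * w₂ * w₃ * (l₁ + l₂ + l₃) ^ 2
      = w₃ * (l₁ * w₂ - l₂ * w₁) ^ 2 + w₂ * (l₁ * w₃ - l₃ * w₁) ^ 2
        + w₁ * (l₂ * w₃ - l₃ * w₂) ^ 2 := by
  ring

/-- Weighted Cauchy–Schwarz, three terms: `w₁w₂w₃ (Σ lⱼ)² ≤ (Σ wⱼ) · Σⱼ (∏_{i≠j} wᵢ) lⱼ²`.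
[folklore] -/
theorem weightedCS_three_le (l₁ l₂ l₃ w₁ w₂ w₃ : ℝ) (h₁ : 0 ≤ w₁) (h₂ : 0 ≤ w₂)
    (h₃ : 0 ≤ w₃) :
    w₁ * w₂ * w₃ * (l₁ + l₂ + l₃) ^ 2
      ≤ (w₁ + w₂ + w₃) * (w₂ * w₃ * l₁ ^ 2 + w₁ * w₃ * l₂ ^ 2 + w₁ * w₂ * l₃ ^ 2) := by
  have e := weightedCS_three_eq l₁ l₂ l₃ w₁ w₂ w₃
  have s₁ := mul_nonneg h₃ (sq_nonneg (l₁ * w₂ - l₂ * w₁))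
  have s₂ := mul_nonneg h₂ (sq_nonneg (l₁ * w₃ - l₃ * w₁))
  have s₃ := mul_nonneg h₁ (sq_nonneg (l₂ * w₃ - l₃ * w₂))
  linarith

/-- (E1) at `n = 4`, `k = 3`, level `x₄`: `out₃(4) ≤ ((1-w₄)/w₄) · in₃(4)` on the simplex,
in the `w₄`-free form `w₁w₂w₃ Δ(123)² ≤ (w₁+w₂+w₃)(w₂w₃Δ(234)² + w₁w₃Δ(134)² + w₁w₂Δ(124)²)`.
[folklore] -/
theorem exchange_three (x₁ x₂ x₃ x₄ w₁ w₂ w₃ : ℝ) (h₁ : 0 ≤ w₁) (h₂ : 0 ≤ w₂) (h₃ : 0 ≤ w₃) :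
    w₁ * w₂ * w₃ * ((x₂ - x₁) * (x₃ - x₁) * (x₃ - x₂)) ^ 2
      ≤ (w₁ + w₂ + w₃) *
          (w₂ * w₃ * ((x₃ - x₂) * (x₄ - x₂) * (x₄ - x₃)) ^ 2
            + w₁ * w₃ * ((x₃ - x₁) * (x₄ - x₁) * (x₄ - x₃)) ^ 2
            + w₁ * w₂ * ((x₂ - x₁) * (x₄ - x₁) * (x₄ - x₂)) ^ 2) := by
  have hV := lagrange_three x₁ x₂ x₃ x₄
  have key := weightedCS_three_le ((x₃ - x₂) * (x₄ - x₂) * (x₄ - x₃))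
    (-((x₃ - x₁) * (x₄ - x₁) * (x₄ - x₃))) ((x₂ - x₁) * (x₄ - x₁) * (x₄ - x₂)) w₁ w₂ w₃ h₁ h₂ h₃
  have hV' : (x₃ - x₂) * (x₄ - x₂) * (x₄ - x₃) + -((x₃ - x₁) * (x₄ - x₁) * (x₄ - x₃))
      + (x₂ - x₁) * (x₄ - x₁) * (x₄ - x₂) = (x₂ - x₁) * (x₃ - x₁) * (x₃ - x₂) := by ring
  rw [hV'] at key
  have hsq : (-((x₃ - x₁) * (x₄ - x₁) * (x₄ - x₃))) ^ 2
      = ((x₃ - x₁) * (x₄ - x₁) * (x₄ - x₃)) ^ 2 := by ring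
  rw [hsq] at key
  exact key

/-! ## (E3): the quadratic minimum and the pair lower bound -/

/-- `min_y (p (y-a)² + q (y-b)²) = pq (a-b)²/(p+q)`, as a cleared identity.  [folklore] -/
theorem quadMin_eq (y a b p q : ℝ) :
    (p + q) * (p * (y - a) ^ 2 + q * (y - b) ^ 2) - p * q * (a - b) ^ 2
      = (p * (y - a) + q * (y - b)) ^ 2 := by
  ring

/-- (E3) at `n = 4`: for the pair `{3,4}` with the other levels `1, 2`,
`(w₁+w₂+w₃+w₄) · w₃w₄ d₃₄² ≤ (w₃ + w₄) · D₂(w)` (all weights nonnegative).  [folklore] -/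
theorem pair_lower (x₁ x₂ x₃ x₄ w₁ w₂ w₃ w₄ : ℝ) (h₁ : 0 ≤ w₁) (h₂ : 0 ≤ w₂) (h₃ : 0 ≤ w₃)
    (h₄ : 0 ≤ w₄) :
    (w₁ + w₂ + w₃ + w₄) * (w₃ * w₄ * (x₃ - x₄) ^ 2)
      ≤ (w₃ + w₄) *
          (w₁ * w₂ * (x₁ - x₂) ^ 2 + w₁ * w₃ * (x₁ - x₃) ^ 2 + w₁ * w₄ * (x₁ - x₄) ^ 2
            + w₂ * w₃ * (x₂ - x₃) ^ 2 + w₂ * w₄ * (x₂ - x₄) ^ 2 + w₃ * w₄ * (x₃ - x₄) ^ 2) := by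
  have q₁ : w₃ * w₄ * (x₃ - x₄) ^ 2 ≤ (w₃ + w₄) * (w₃ * (x₁ - x₃) ^ 2 + w₄ * (x₁ - x₄) ^ 2) := by
    have := quadMin_eq x₁ x₃ x₄ w₃ w₄
    nlinarith [sq_nonneg (w₃ * (x₁ - x₃) + w₄ * (x₁ - x₄))]
  have q₂ : w₃ * w₄ * (x₃ - x₄) ^ 2 ≤ (w₃ + w₄) * (w₃ * (x₂ - x₃) ^ 2 + w₄ * (x₂ - x₄) ^ 2) := by
    have := quadMin_eq x₂ x₃ x₄ w₃ w₄
    nlinarith [sq_nonneg (w₃ * (x₂ - x₃) + w₄ * (x₂ - x₄))]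
  have m₁ := mul_le_mul_of_nonneg_left q₁ h₁
  have m₂ := mul_le_mul_of_nonneg_left q₂ h₂
  have s := mul_nonneg (mul_nonneg (add_nonneg h₃ h₄) (mul_nonneg h₁ h₂)) (sq_nonneg (x₁ - x₂))
  nlinarith [m₁, m₂, s]

/-! ## The cover lemma (G.20), abstract form -/

set_option maxHeartbeats 1600000 in
/-- COVER LEMMA, abstract all-β form.  Weights `w ∈ Δ₃°`; nonnegative pair terms `A_ij` and
triple terms `C_m`; (E1) for every level at `k = 2, 3`; the six pair bounds (E3).  Then some
level `m` is GOOD-B: `w_m ≥ 1/10`, `out₂(m) ≤ 3 in₂(m)`, `out₃(m) ≤ 3 in₃(m)`.  [folklore] -/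
theorem coverB_four_abstract
    (w₁ w₂ w₃ w₄ A₁₂ A₁₃ A₁₄ A₂₃ A₂₄ A₃₄ C₁ C₂ C₃ C₄ : ℝ)
    (hw₁ : 0 < w₁) (hw₂ : 0 < w₂) (hw₃ : 0 < w₃) (hw₄ : 0 < w₄)
    (hs : w₁ + w₂ + w₃ + w₄ = 1)
    (a₁₂ : 0 ≤ A₁₂) (a₁₃ : 0 ≤ A₁₃) (a₁₄ : 0 ≤ A₁₄) (a₂₃ : 0 ≤ A₂₃) (a₂₄ : 0 ≤ A₂₄)
    (a₃₄ : 0 ≤ A₃₄) (c₁ : 0 ≤ C₁) (c₂ : 0 ≤ C₂) (c₃ : 0 ≤ C₃) (c₄ : 0 ≤ C₄)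
    (e₁ : w₁ * (A₂₃ + A₂₄ + A₃₄) ≤ 2 * (w₂ + w₃ + w₄) * (A₁₂ + A₁₃ + A₁₄))
    (e₂ : w₂ * (A₁₃ + A₁₄ + A₃₄) ≤ 2 * (w₁ + w₃ + w₄) * (A₁₂ + A₂₃ + A₂₄))
    (e₃ : w₃ * (A₁₂ + A₁₄ + A₂₄) ≤ 2 * (w₁ + w₂ + w₄) * (A₁₃ + A₂₃ + A₃₄))
    (e₄ : w₄ * (A₁₂ + A₁₃ + A₂₃) ≤ 2 * (w₁ + w₂ + w₃) * (A₁₄ + A₂₄ + A₃₄))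
    (E₁ : w₁ * C₁ ≤ (w₂ + w₃ + w₄) * (C₂ + C₃ + C₄))
    (E₂ : w₂ * C₂ ≤ (w₁ + w₃ + w₄) * (C₁ + C₃ + C₄))
    (E₃ : w₃ * C₃ ≤ (w₁ + w₂ + w₄) * (C₁ + C₂ + C₄))
    (E₄ : w₄ * C₄ ≤ (w₁ + w₂ + w₃) * (C₁ + C₂ + C₃))
    (p₁₂ : (w₁ + w₂ + w₃ + w₄) * A₁₂ ≤ (w₁ + w₂) * (A₁₂ + A₁₃ + A₁₄ + A₂₃ + A₂₄ + A₃₄))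
    (p₁₃ : (w₁ + w₂ + w₃ + w₄) * A₁₃ ≤ (w₁ + w₃) * (A₁₂ + A₁₃ + A₁₄ + A₂₃ + A₂₄ + A₃₄))
    (p₁₄ : (w₁ + w₂ + w₃ + w₄) * A₁₄ ≤ (w₁ + w₄) * (A₁₂ + A₁₃ + A₁₄ + A₂₃ + A₂₄ + A₃₄))
    (p₂₃ : (w₁ + w₂ + w₃ + w₄) * A₂₃ ≤ (w₂ + w₃) * (A₁₂ + A₁₃ + A₁₄ + A₂₃ + A₂₄ + A₃₄))
    (p₂₄ : (w₁ + w₂ + w₃ + w₄) * A₂₄ ≤ (w₂ + w₄) * (A₁₂ + A₁₃ + A₁₄ + A₂₃ + A₂₄ + A₃₄))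
    (p₃₄ : (w₁ + w₂ + w₃ + w₄) * A₃₄ ≤ (w₃ + w₄) * (A₁₂ + A₁₃ + A₁₄ + A₂₃ + A₂₄ + A₃₄)) :
    (1/10 ≤ w₁ ∧ A₂₃ + A₂₄ + A₃₄ ≤ 3 * (A₁₂ + A₁₃ + A₁₄) ∧ C₁ ≤ 3 * (C₂ + C₃ + C₄))
    ∨ (1/10 ≤ w₂ ∧ A₁₃ + A₁₄ + A₃₄ ≤ 3 * (A₁₂ + A₂₃ + A₂₄) ∧ C₂ ≤ 3 * (C₁ + C₃ + C₄))
    ∨ (1/10 ≤ w₃ ∧ A₁₂ + A₁₄ + A₂₄ ≤ 3 * (A₁₃ + A₂₃ + A₃₄) ∧ C₃ ≤ 3 * (C₁ + C₂ + C₄))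
    ∨ (1/10 ≤ w₄ ∧ A₁₂ + A₁₃ + A₂₃ ≤ 3 * (A₁₄ + A₂₄ + A₃₄) ∧ C₄ ≤ 3 * (C₁ + C₂ + C₃)) := by
  -- (E1) with Σ w = 1 substituted
  have e₁' : w₁ * (A₂₃ + A₂₄ + A₃₄) ≤ 2 * (1 - w₁) * (A₁₂ + A₁₃ + A₁₄) := by
    rw [show w₂ + w₃ + w₄ = 1 - w₁ by linarith] at e₁; exact e₁
  have e₂' : w₂ * (A₁₃ + A₁₄ + A₃₄) ≤ 2 * (1 - w₂) * (A₁₂ + A₂₃ + A₂₄) := by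
    rw [show w₁ + w₃ + w₄ = 1 - w₂ by linarith] at e₂; exact e₂
  have e₃' : w₃ * (A₁₂ + A₁₄ + A₂₄) ≤ 2 * (1 - w₃) * (A₁₃ + A₂₃ + A₃₄) := by
    rw [show w₁ + w₂ + w₄ = 1 - w₃ by linarith] at e₃; exact e₃
  have e₄' : w₄ * (A₁₂ + A₁₃ + A₂₃) ≤ 2 * (1 - w₄) * (A₁₄ + A₂₄ + A₃₄) := by
    rw [show w₁ + w₂ + w₃ = 1 - w₄ by linarith] at e₄; exact e₄
  have E₁' : w₁ * C₁ ≤ (1 - w₁) * (C₂ + C₃ + C₄) := by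
    rw [show w₂ + w₃ + w₄ = 1 - w₁ by linarith] at E₁; exact E₁
  have E₂' : w₂ * C₂ ≤ (1 - w₂) * (C₁ + C₃ + C₄) := by
    rw [show w₁ + w₃ + w₄ = 1 - w₂ by linarith] at E₂; exact E₂
  have E₃' : w₃ * C₃ ≤ (1 - w₃) * (C₁ + C₂ + C₄) := by
    rw [show w₁ + w₂ + w₄ = 1 - w₃ by linarith] at E₃; exact E₃
  have E₄' : w₄ * C₄ ≤ (1 - w₄) * (C₁ + C₂ + C₃) := by
    rw [show w₁ + w₂ + w₃ = 1 - w₄ by linarith] at E₄; exact E₄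
  -- (E3) with Σ w = 1
  rw [hs, one_mul] at p₁₂ p₁₃ p₁₄ p₂₃ p₂₄ p₃₄
  have hP : 0 ≤ A₁₂ + A₁₃ + A₁₄ + A₂₃ + A₂₄ + A₃₄ := by linarith
  -- Step 1: a level of weight ≥ 2/5 is GOOD-B
  by_cases H₁ : 2/5 ≤ w₁
  · refine Or.inl ⟨by linarith, ?_, ?_⟩
    · have p1 := mul_nonneg (sub_nonneg.2 H₁) (show (0:ℝ) ≤ A₂₃ + A₂₄ + A₃₄ by linarith)
      have p2 := mul_nonneg (sub_nonneg.2 H₁) (show (0:ℝ) ≤ A₁₂ + A₁₃ + A₁₄ by linarith)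
      linarith only [e₁', p1, p2]
    · have p3 := mul_nonneg (sub_nonneg.2 H₁) c₁
      have p4 := mul_nonneg (sub_nonneg.2 H₁) (show (0:ℝ) ≤ C₂ + C₃ + C₄ by linarith)
      linarith only [E₁', p3, p4, c₁, c₂, c₃, c₄]
  by_cases H₂ : 2/5 ≤ w₂
  · refine Or.inr (Or.inl ⟨by linarith, ?_, ?_⟩)
    · have p1 := mul_nonneg (sub_nonneg.2 H₂) (show (0:ℝ) ≤ A₁₃ + A₁₄ + A₃₄ by linarith)
      have p2 := mul_nonneg (sub_nonneg.2 H₂) (show (0:ℝ) ≤ A₁₂ + A₂₃ + A₂₄ by linarith)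
      linarith only [e₂', p1, p2]
    · have p3 := mul_nonneg (sub_nonneg.2 H₂) c₂
      have p4 := mul_nonneg (sub_nonneg.2 H₂) (show (0:ℝ) ≤ C₁ + C₃ + C₄ by linarith)
      linarith only [E₂', p3, p4, c₁, c₂, c₃, c₄]
  by_cases H₃ : 2/5 ≤ w₃
  · refine Or.inr (Or.inr (Or.inl ⟨by linarith, ?_, ?_⟩))
    · have p1 := mul_nonneg (sub_nonneg.2 H₃) (show (0:ℝ) ≤ A₁₂ + A₁₄ + A₂₄ by linarith)
      have p2 := mul_nonneg (sub_nonneg.2 H₃) (show (0:ℝ) ≤ A₁₃ + A₂₃ + A₃₄ by linarith)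
      linarith only [e₃', p1, p2]
    · have p3 := mul_nonneg (sub_nonneg.2 H₃) c₃
      have p4 := mul_nonneg (sub_nonneg.2 H₃) (show (0:ℝ) ≤ C₁ + C₂ + C₄ by linarith)
      linarith only [E₃', p3, p4, c₁, c₂, c₃, c₄]
  by_cases H₄ : 2/5 ≤ w₄
  · refine Or.inr (Or.inr (Or.inr ⟨by linarith, ?_, ?_⟩))
    · have p1 := mul_nonneg (sub_nonneg.2 H₄) (show (0:ℝ) ≤ A₁₂ + A₁₃ + A₂₃ by linarith)
      have p2 := mul_nonneg (sub_nonneg.2 H₄) (show (0:ℝ) ≤ A₁₄ + A₂₄ + A₃₄ by linarith)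
      linarith only [e₄', p1, p2]
    · have p3 := mul_nonneg (sub_nonneg.2 H₄) c₄
      have p4 := mul_nonneg (sub_nonneg.2 H₄) (show (0:ℝ) ≤ C₁ + C₂ + C₃ by linarith)
      linarith only [E₄', p3, p4, c₁, c₂, c₃, c₄]
  replace H₁ := not_le.mp H₁; replace H₂ := not_le.mp H₂
  replace H₃ := not_le.mp H₃; replace H₄ := not_le.mp H₄
  -- Step 5: a Y-level (out₃ > 3 in₃) weighs < 1/4
  have s5₁ : 3 * (C₂ + C₃ + C₄) < C₁ → w₁ < 1/4 := by
    intro h; by_contra hh; replace hh := not_lt.mp hh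
    have p3 := mul_nonneg (sub_nonneg.2 hh) c₁
    have p4 := mul_nonneg (sub_nonneg.2 hh) (show (0:ℝ) ≤ C₂ + C₃ + C₄ by linarith)
    linarith only [E₁', p3, p4, c₁, c₂, c₃, c₄, h]
  have s5₂ : 3 * (C₁ + C₃ + C₄) < C₂ → w₂ < 1/4 := by
    intro h; by_contra hh; replace hh := not_lt.mp hh
    have p3 := mul_nonneg (sub_nonneg.2 hh) c₂
    have p4 := mul_nonneg (sub_nonneg.2 hh) (show (0:ℝ) ≤ C₁ + C₃ + C₄ by linarith)
    linarith only [E₂', p3, p4, c₁, c₂, c₃, c₄, h]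
  have s5₃ : 3 * (C₁ + C₂ + C₄) < C₃ → w₃ < 1/4 := by
    intro h; by_contra hh; replace hh := not_lt.mp hh
    have p3 := mul_nonneg (sub_nonneg.2 hh) c₃
    have p4 := mul_nonneg (sub_nonneg.2 hh) (show (0:ℝ) ≤ C₁ + C₂ + C₄ by linarith)
    linarith only [E₃', p3, p4, c₁, c₂, c₃, c₄, h]
  have s5₄ : 3 * (C₁ + C₂ + C₃) < C₄ → w₄ < 1/4 := by
    intro h; by_contra hh; replace hh := not_lt.mp hh
    have p3 := mul_nonneg (sub_nonneg.2 hh) c₄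
    have p4 := mul_nonneg (sub_nonneg.2 hh) (show (0:ℝ) ≤ C₁ + C₂ + C₃ by linarith)
    linarith only [E₄', p3, p4, c₁, c₂, c₃, c₄, h]
  -- Step 6 input: a pair of levels both lighter than 1/4 carries at most half of D₂
  have s6₁₂ : w₁ < 1/4 → w₂ < 1/4 → A₁₂ ≤ (A₁₂ + A₁₃ + A₁₄ + A₂₃ + A₂₄ + A₃₄) / 2 := by
    intro h h'
    have := mul_nonneg (show (0:ℝ) ≤ 1/2 - w₁ - w₂ by linarith) hP
    linarith only [p₁₂, this]
  have s6₁₃ : w₁ < 1/4 → w₃ < 1/4 → A₁₃ ≤ (A₁₂ + A₁₃ + A₁₄ + A₂₃ + A₂₄ + A₃₄) / 2 := by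
    intro h h'
    have := mul_nonneg (show (0:ℝ) ≤ 1/2 - w₁ - w₃ by linarith) hP
    linarith only [p₁₃, this]
  have s6₁₄ : w₁ < 1/4 → w₄ < 1/4 → A₁₄ ≤ (A₁₂ + A₁₃ + A₁₄ + A₂₃ + A₂₄ + A₃₄) / 2 := by
    intro h h'
    have := mul_nonneg (show (0:ℝ) ≤ 1/2 - w₁ - w₄ by linarith) hP
    linarith only [p₁₄, this]
  have s6₂₃ : w₂ < 1/4 → w₃ < 1/4 → A₂₃ ≤ (A₁₂ + A₁₃ + A₁₄ + A₂₃ + A₂₄ + A₃₄) / 2 := by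
    intro h h'
    have := mul_nonneg (show (0:ℝ) ≤ 1/2 - w₂ - w₃ by linarith) hP
    linarith only [p₂₃, this]
  have s6₂₄ : w₂ < 1/4 → w₄ < 1/4 → A₂₄ ≤ (A₁₂ + A₁₃ + A₁₄ + A₂₃ + A₂₄ + A₃₄) / 2 := by
    intro h h'
    have := mul_nonneg (show (0:ℝ) ≤ 1/2 - w₂ - w₄ by linarith) hP
    linarith only [p₂₄, this]
  have s6₃₄ : w₃ < 1/4 → w₄ < 1/4 → A₃₄ ≤ (A₁₂ + A₁₃ + A₁₄ + A₂₃ + A₂₄ + A₃₄) / 2 := by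
    intro h h'
    have := mul_nonneg (show (0:ℝ) ≤ 1/2 - w₃ - w₄ by linarith) hP
    linarith only [p₃₄, this]
  -- Step 3: every level is GOOD-B, light (< 1/10), of type X (out₂ > 3 in₂) or of type Y
  have t₁ : (1/10 ≤ w₁ ∧ A₂₃ + A₂₄ + A₃₄ ≤ 3 * (A₁₂ + A₁₃ + A₁₄) ∧ C₁ ≤ 3 * (C₂ + C₃ + C₄))
      ∨ (w₁ < 1/10 ∨ 3 * (A₁₂ + A₁₃ + A₁₄) < A₂₃ + A₂₄ + A₃₄
          ∨ (3 * (C₂ + C₃ + C₄) < C₁ ∧ w₁ < 1/4)) := by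
    by_cases hl : w₁ < 1/10
    · exact Or.inr (Or.inl hl)
    by_cases b2 : A₂₃ + A₂₄ + A₃₄ ≤ 3 * (A₁₂ + A₁₃ + A₁₄)
    · by_cases b3 : C₁ ≤ 3 * (C₂ + C₃ + C₄)
      · exact Or.inl ⟨not_lt.mp hl, b2, b3⟩
      · exact Or.inr (Or.inr (Or.inr ⟨not_le.mp b3, s5₁ (not_le.mp b3)⟩))
    · exact Or.inr (Or.inr (Or.inl (not_le.mp b2)))
  have t₂ : (1/10 ≤ w₂ ∧ A₁₃ + A₁₄ + A₃₄ ≤ 3 * (A₁₂ + A₂₃ + A₂₄) ∧ C₂ ≤ 3 * (C₁ + C₃ + C₄))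
      ∨ (w₂ < 1/10 ∨ 3 * (A₁₂ + A₂₃ + A₂₄) < A₁₃ + A₁₄ + A₃₄
          ∨ (3 * (C₁ + C₃ + C₄) < C₂ ∧ w₂ < 1/4)) := by
    by_cases hl : w₂ < 1/10
    · exact Or.inr (Or.inl hl)
    by_cases b2 : A₁₃ + A₁₄ + A₃₄ ≤ 3 * (A₁₂ + A₂₃ + A₂₄)
    · by_cases b3 : C₂ ≤ 3 * (C₁ + C₃ + C₄)
      · exact Or.inl ⟨not_lt.mp hl, b2, b3⟩
      · exact Or.inr (Or.inr (Or.inr ⟨not_le.mp b3, s5₂ (not_le.mp b3)⟩))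
    · exact Or.inr (Or.inr (Or.inl (not_le.mp b2)))
  have t₃ : (1/10 ≤ w₃ ∧ A₁₂ + A₁₄ + A₂₄ ≤ 3 * (A₁₃ + A₂₃ + A₃₄) ∧ C₃ ≤ 3 * (C₁ + C₂ + C₄))
      ∨ (w₃ < 1/10 ∨ 3 * (A₁₃ + A₂₃ + A₃₄) < A₁₂ + A₁₄ + A₂₄
          ∨ (3 * (C₁ + C₂ + C₄) < C₃ ∧ w₃ < 1/4)) := by
    by_cases hl : w₃ < 1/10
    · exact Or.inr (Or.inl hl)
    by_cases b2 : A₁₂ + A₁₄ + A₂₄ ≤ 3 * (A₁₃ + A₂₃ + A₃₄)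
    · by_cases b3 : C₃ ≤ 3 * (C₁ + C₂ + C₄)
      · exact Or.inl ⟨not_lt.mp hl, b2, b3⟩
      · exact Or.inr (Or.inr (Or.inr ⟨not_le.mp b3, s5₃ (not_le.mp b3)⟩))
    · exact Or.inr (Or.inr (Or.inl (not_le.mp b2)))
  have t₄ : (1/10 ≤ w₄ ∧ A₁₂ + A₁₃ + A₂₃ ≤ 3 * (A₁₄ + A₂₄ + A₃₄) ∧ C₄ ≤ 3 * (C₁ + C₂ + C₃))
      ∨ (w₄ < 1/10 ∨ 3 * (A₁₄ + A₂₄ + A₃₄) < A₁₂ + A₁₃ + A₂₃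
          ∨ (3 * (C₁ + C₂ + C₃) < C₄ ∧ w₄ < 1/4)) := by
    by_cases hl : w₄ < 1/10
    · exact Or.inr (Or.inl hl)
    by_cases b2 : A₁₂ + A₁₃ + A₂₃ ≤ 3 * (A₁₄ + A₂₄ + A₃₄)
    · by_cases b3 : C₄ ≤ 3 * (C₁ + C₂ + C₃)
      · exact Or.inl ⟨not_lt.mp hl, b2, b3⟩
      · exact Or.inr (Or.inr (Or.inr ⟨not_le.mp b3, s5₄ (not_le.mp b3)⟩))
    · exact Or.inr (Or.inr (Or.inl (not_le.mp b2)))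
  rcases t₁ with g₁ | r₁
  · exact Or.inl g₁
  rcases t₂ with g₂ | r₂
  · exact Or.inr (Or.inl g₂)
  rcases t₃ with g₃ | r₃
  · exact Or.inr (Or.inr (Or.inl g₃))
  rcases t₄ with g₄ | r₄
  · exact Or.inr (Or.inr (Or.inr g₄))
  exfalso
  -- Steps 2, 4, 6: at most one light level, at most one Y, at most two X; the surviving
  -- pattern {X, X, Y, light} contradicts (E3) for the pair {Y, light}.
  clear e₁ e₂ e₃ e₄ E₁ E₂ E₃ E₄ e₁' e₂' e₃' e₄' E₁' E₂' E₃' E₄' s5₁ s5₂ s5₃ s5₄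
    p₁₂ p₁₃ p₁₄ p₂₃ p₂₄ p₃₄ hP
  rcases r₁ with l₁ | X₁ | ⟨Y₁, y₁⟩ <;> rcases r₂ with l₂ | X₂ | ⟨Y₂, y₂⟩ <;>
    rcases r₃ with l₃ | X₃ | ⟨Y₃, y₃⟩ <;> rcases r₄ with l₄ | X₄ | ⟨Y₄, y₄⟩
  all_goals
    first
    | linarith
    | linarith [s6₁₂ (by linarith) (by linarith)]
    | linarith [s6₁₃ (by linarith) (by linarith)]
    | linarith [s6₁₄ (by linarith) (by linarith)]
    | linarith [s6₂₃ (by linarith) (by linarith)]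
    | linarith [s6₂₄ (by linarith) (by linarith)]
    | linarith [s6₃₄ (by linarith) (by linarith)]

/-! ## The cover lemma for four weighted points on a line -/

set_option maxHeartbeats 1600000 in
/-- COVER LEMMA (DENSITY-XY G.20, sharpened all-β form), `n = 4`, `θ = 1/3`, `δ = 1/10`:
for any reals `x₁ … x₄` and any `w` in the open simplex some level `m` has `w_m ≥ 1/10`,
`out₂(m) ≤ 3 · in₂(m)` and `out₃(m) ≤ 3 · in₃(m)`, written out in the pair terms
`w_i w_j (x_i - x_j)²` and the triple terms `(∏_{j≠m} w_j) Δ(x_{-m})²`.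
[cite: ImbrieJSP2016, §4.2.1]  [folklore] -/
theorem coverB_four (x₁ x₂ x₃ x₄ w₁ w₂ w₃ w₄ : ℝ) (hw₁ : 0 < w₁) (hw₂ : 0 < w₂)
    (hw₃ : 0 < w₃) (hw₄ : 0 < w₄) (hs : w₁ + w₂ + w₃ + w₄ = 1) :
    (1/10 ≤ w₁
      ∧ w₂ * w₃ * (x₂ - x₃) ^ 2 + w₂ * w₄ * (x₂ - x₄) ^ 2 + w₃ * w₄ * (x₃ - x₄) ^ 2
          ≤ 3 * (w₁ * w₂ * (x₁ - x₂) ^ 2 + w₁ * w₃ * (x₁ - x₃) ^ 2 + w₁ * w₄ * (x₁ - x₄) ^ 2)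
      ∧ w₂ * w₃ * w₄ * ((x₃ - x₂) * (x₄ - x₂) * (x₄ - x₃)) ^ 2
          ≤ 3 * (w₁ * w₃ * w₄ * ((x₃ - x₁) * (x₄ - x₁) * (x₄ - x₃)) ^ 2
                + w₁ * w₂ * w₄ * ((x₂ - x₁) * (x₄ - x₁) * (x₄ - x₂)) ^ 2
                + w₁ * w₂ * w₃ * ((x₂ - x₁) * (x₃ - x₁) * (x₃ - x₂)) ^ 2))
    ∨ (1/10 ≤ w₂
      ∧ w₁ * w₃ * (x₁ - x₃) ^ 2 + w₁ * w₄ * (x₁ - x₄) ^ 2 + w₃ * w₄ * (x₃ - x₄) ^ 2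
          ≤ 3 * (w₁ * w₂ * (x₁ - x₂) ^ 2 + w₂ * w₃ * (x₂ - x₃) ^ 2 + w₂ * w₄ * (x₂ - x₄) ^ 2)
      ∧ w₁ * w₃ * w₄ * ((x₃ - x₁) * (x₄ - x₁) * (x₄ - x₃)) ^ 2
          ≤ 3 * (w₂ * w₃ * w₄ * ((x₃ - x₂) * (x₄ - x₂) * (x₄ - x₃)) ^ 2
                + w₁ * w₂ * w₄ * ((x₂ - x₁) * (x₄ - x₁) * (x₄ - x₂)) ^ 2
                + w₁ * w₂ * w₃ * ((x₂ - x₁) * (x₃ - x₁) * (x₃ - x₂)) ^ 2))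
    ∨ (1/10 ≤ w₃
      ∧ w₁ * w₂ * (x₁ - x₂) ^ 2 + w₁ * w₄ * (x₁ - x₄) ^ 2 + w₂ * w₄ * (x₂ - x₄) ^ 2
          ≤ 3 * (w₁ * w₃ * (x₁ - x₃) ^ 2 + w₂ * w₃ * (x₂ - x₃) ^ 2 + w₃ * w₄ * (x₃ - x₄) ^ 2)
      ∧ w₁ * w₂ * w₄ * ((x₂ - x₁) * (x₄ - x₁) * (x₄ - x₂)) ^ 2
          ≤ 3 * (w₂ * w₃ * w₄ * ((x₃ - x₂) * (x₄ - x₂) * (x₄ - x₃)) ^ 2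
                + w₁ * w₃ * w₄ * ((x₃ - x₁) * (x₄ - x₁) * (x₄ - x₃)) ^ 2
                + w₁ * w₂ * w₃ * ((x₂ - x₁) * (x₃ - x₁) * (x₃ - x₂)) ^ 2))
    ∨ (1/10 ≤ w₄
      ∧ w₁ * w₂ * (x₁ - x₂) ^ 2 + w₁ * w₃ * (x₁ - x₃) ^ 2 + w₂ * w₃ * (x₂ - x₃) ^ 2
          ≤ 3 * (w₁ * w₄ * (x₁ - x₄) ^ 2 + w₂ * w₄ * (x₂ - x₄) ^ 2 + w₃ * w₄ * (x₃ - x₄) ^ 2)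
      ∧ w₁ * w₂ * w₃ * ((x₂ - x₁) * (x₃ - x₁) * (x₃ - x₂)) ^ 2
          ≤ 3 * (w₂ * w₃ * w₄ * ((x₃ - x₂) * (x₄ - x₂) * (x₄ - x₃)) ^ 2
                + w₁ * w₃ * w₄ * ((x₃ - x₁) * (x₄ - x₁) * (x₄ - x₃)) ^ 2
                + w₁ * w₂ * w₄ * ((x₂ - x₁) * (x₄ - x₁) * (x₄ - x₂)) ^ 2)) := by
  have h₁ := hw₁.le; have h₂ := hw₂.le; have h₃ := hw₃.le; have h₄ := hw₄.le
  refine coverB_four_abstract w₁ w₂ w₃ w₄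
    (w₁ * w₂ * (x₁ - x₂) ^ 2) (w₁ * w₃ * (x₁ - x₃) ^ 2) (w₁ * w₄ * (x₁ - x₄) ^ 2)
    (w₂ * w₃ * (x₂ - x₃) ^ 2) (w₂ * w₄ * (x₂ - x₄) ^ 2) (w₃ * w₄ * (x₃ - x₄) ^ 2)
    (w₂ * w₃ * w₄ * ((x₃ - x₂) * (x₄ - x₂) * (x₄ - x₃)) ^ 2)
    (w₁ * w₃ * w₄ * ((x₃ - x₁) * (x₄ - x₁) * (x₄ - x₃)) ^ 2)
    (w₁ * w₂ * w₄ * ((x₂ - x₁) * (x₄ - x₁) * (x₄ - x₂)) ^ 2)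
    (w₁ * w₂ * w₃ * ((x₂ - x₁) * (x₃ - x₁) * (x₃ - x₂)) ^ 2)
    hw₁ hw₂ hw₃ hw₄ hs
    (by positivity) (by positivity) (by positivity) (by positivity) (by positivity)
    (by positivity) (by positivity) (by positivity) (by positivity) (by positivity)
    ?_ ?_ ?_ ?_ ?_ ?_ ?_ ?_ ?_ ?_ ?_ ?_ ?_ ?_
  -- (E1), k = 2, for the levels 1, 2, 3, 4
  · have h := mul_le_mul_of_nonneg_left (exchange_two x₂ x₃ x₄ x₁ w₂ w₃ w₄ h₂ h₃ h₄) h₁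
    linarith
  · have h := mul_le_mul_of_nonneg_left (exchange_two x₁ x₃ x₄ x₂ w₁ w₃ w₄ h₁ h₃ h₄) h₂
    linarith
  · have h := mul_le_mul_of_nonneg_left (exchange_two x₁ x₂ x₄ x₃ w₁ w₂ w₄ h₁ h₂ h₄) h₃
    linarith
  · have h := mul_le_mul_of_nonneg_left (exchange_two x₁ x₂ x₃ x₄ w₁ w₂ w₃ h₁ h₂ h₃) h₄
    linarith
  -- (E1), k = 3
  · have h := mul_le_mul_of_nonneg_left (exchange_three x₂ x₃ x₄ x₁ w₂ w₃ w₄ h₂ h₃ h₄) h₁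
    linarith
  · have h := mul_le_mul_of_nonneg_left (exchange_three x₁ x₃ x₄ x₂ w₁ w₃ w₄ h₁ h₃ h₄) h₂
    linarith
  · have h := mul_le_mul_of_nonneg_left (exchange_three x₁ x₂ x₄ x₃ w₁ w₂ w₄ h₁ h₂ h₄) h₃
    linarith
  · have h := mul_le_mul_of_nonneg_left (exchange_three x₁ x₂ x₃ x₄ w₁ w₂ w₃ h₁ h₂ h₃) h₄
    linarith
  -- (E3) for the six pairs
  · linarith [pair_lower x₃ x₄ x₁ x₂ w₃ w₄ w₁ w₂ h₃ h₄ h₁ h₂]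
  · linarith [pair_lower x₂ x₄ x₁ x₃ w₂ w₄ w₁ w₃ h₂ h₄ h₁ h₃]
  · linarith [pair_lower x₂ x₃ x₁ x₄ w₂ w₃ w₁ w₄ h₂ h₃ h₁ h₄]
  · linarith [pair_lower x₁ x₄ x₂ x₃ w₁ w₄ w₂ w₃ h₁ h₄ h₂ h₃]
  · linarith [pair_lower x₁ x₃ x₂ x₄ w₁ w₃ w₂ w₄ h₁ h₃ h₂ h₄]
  · linarith [pair_lower x₁ x₂ x₃ x₄ w₁ w₂ w₃ w₄ h₁ h₂ h₃ h₄]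


/-- COVER LEMMA G.20 exactly as landed in DENSITY-XY ADDENDUM G″ (B-or-A form): some level `m`
is GOOD-B (`w_m ≥ 1/10`, `out_k(m) ≤ 3 in_k(m)`, `k = 2,3`) or GOOD-A (`w_m ≤ 2/5`,
`in_k(m) ≤ 3 out_k(m)`, `k = 2,3`).  Immediate from `coverB_four`.  [folklore] -/
theorem cover_four (x₁ x₂ x₃ x₄ w₁ w₂ w₃ w₄ : ℝ) (hw₁ : 0 < w₁) (hw₂ : 0 < w₂)
    (hw₃ : 0 < w₃) (hw₄ : 0 < w₄) (hs : w₁ + w₂ + w₃ + w₄ = 1) :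
    ((1/10 ≤ w₁
        ∧ w₂ * w₃ * (x₂ - x₃) ^ 2 + w₂ * w₄ * (x₂ - x₄) ^ 2 + w₃ * w₄ * (x₃ - x₄) ^ 2
            ≤ 3 * (w₁ * w₂ * (x₁ - x₂) ^ 2 + w₁ * w₃ * (x₁ - x₃) ^ 2 + w₁ * w₄ * (x₁ - x₄) ^ 2)
        ∧ w₂ * w₃ * w₄ * ((x₃ - x₂) * (x₄ - x₂) * (x₄ - x₃)) ^ 2
            ≤ 3 * (w₁ * w₃ * w₄ * ((x₃ - x₁) * (x₄ - x₁) * (x₄ - x₃)) ^ 2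
                + w₁ * w₂ * w₄ * ((x₂ - x₁) * (x₄ - x₁) * (x₄ - x₂)) ^ 2
                + w₁ * w₂ * w₃ * ((x₂ - x₁) * (x₃ - x₁) * (x₃ - x₂)) ^ 2))
      ∨ (w₁ ≤ 2/5
        ∧ w₁ * w₂ * (x₁ - x₂) ^ 2 + w₁ * w₃ * (x₁ - x₃) ^ 2 + w₁ * w₄ * (x₁ - x₄) ^ 2
            ≤ 3 * (w₂ * w₃ * (x₂ - x₃) ^ 2 + w₂ * w₄ * (x₂ - x₄) ^ 2 + w₃ * w₄ * (x₃ - x₄) ^ 2)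
        ∧ w₁ * w₃ * w₄ * ((x₃ - x₁) * (x₄ - x₁) * (x₄ - x₃)) ^ 2
                + w₁ * w₂ * w₄ * ((x₂ - x₁) * (x₄ - x₁) * (x₄ - x₂)) ^ 2
                + w₁ * w₂ * w₃ * ((x₂ - x₁) * (x₃ - x₁) * (x₃ - x₂)) ^ 2
            ≤ 3 * (w₂ * w₃ * w₄ * ((x₃ - x₂) * (x₄ - x₂) * (x₄ - x₃)) ^ 2)))
    ∨ ((1/10 ≤ w₂
        ∧ w₁ * w₃ * (x₁ - x₃) ^ 2 + w₁ * w₄ * (x₁ - x₄) ^ 2 + w₃ * w₄ * (x₃ - x₄) ^ 2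
            ≤ 3 * (w₁ * w₂ * (x₁ - x₂) ^ 2 + w₂ * w₃ * (x₂ - x₃) ^ 2 + w₂ * w₄ * (x₂ - x₄) ^ 2)
        ∧ w₁ * w₃ * w₄ * ((x₃ - x₁) * (x₄ - x₁) * (x₄ - x₃)) ^ 2
            ≤ 3 * (w₂ * w₃ * w₄ * ((x₃ - x₂) * (x₄ - x₂) * (x₄ - x₃)) ^ 2
                + w₁ * w₂ * w₄ * ((x₂ - x₁) * (x₄ - x₁) * (x₄ - x₂)) ^ 2
                + w₁ * w₂ * w₃ * ((x₂ - x₁) * (x₃ - x₁) * (x₃ - x₂)) ^ 2))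
      ∨ (w₂ ≤ 2/5
        ∧ w₁ * w₂ * (x₁ - x₂) ^ 2 + w₂ * w₃ * (x₂ - x₃) ^ 2 + w₂ * w₄ * (x₂ - x₄) ^ 2
            ≤ 3 * (w₁ * w₃ * (x₁ - x₃) ^ 2 + w₁ * w₄ * (x₁ - x₄) ^ 2 + w₃ * w₄ * (x₃ - x₄) ^ 2)
        ∧ w₂ * w₃ * w₄ * ((x₃ - x₂) * (x₄ - x₂) * (x₄ - x₃)) ^ 2
                + w₁ * w₂ * w₄ * ((x₂ - x₁) * (x₄ - x₁) * (x₄ - x₂)) ^ 2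
                + w₁ * w₂ * w₃ * ((x₂ - x₁) * (x₃ - x₁) * (x₃ - x₂)) ^ 2
            ≤ 3 * (w₁ * w₃ * w₄ * ((x₃ - x₁) * (x₄ - x₁) * (x₄ - x₃)) ^ 2)))
    ∨ ((1/10 ≤ w₃
        ∧ w₁ * w₂ * (x₁ - x₂) ^ 2 + w₁ * w₄ * (x₁ - x₄) ^ 2 + w₂ * w₄ * (x₂ - x₄) ^ 2
            ≤ 3 * (w₁ * w₃ * (x₁ - x₃) ^ 2 + w₂ * w₃ * (x₂ - x₃) ^ 2 + w₃ * w₄ * (x₃ - x₄) ^ 2)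
        ∧ w₁ * w₂ * w₄ * ((x₂ - x₁) * (x₄ - x₁) * (x₄ - x₂)) ^ 2
            ≤ 3 * (w₂ * w₃ * w₄ * ((x₃ - x₂) * (x₄ - x₂) * (x₄ - x₃)) ^ 2
                + w₁ * w₃ * w₄ * ((x₃ - x₁) * (x₄ - x₁) * (x₄ - x₃)) ^ 2
                + w₁ * w₂ * w₃ * ((x₂ - x₁) * (x₃ - x₁) * (x₃ - x₂)) ^ 2))
      ∨ (w₃ ≤ 2/5
        ∧ w₁ * w₃ * (x₁ - x₃) ^ 2 + w₂ * w₃ * (x₂ - x₃) ^ 2 + w₃ * w₄ * (x₃ - x₄) ^ 2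
            ≤ 3 * (w₁ * w₂ * (x₁ - x₂) ^ 2 + w₁ * w₄ * (x₁ - x₄) ^ 2 + w₂ * w₄ * (x₂ - x₄) ^ 2)
        ∧ w₂ * w₃ * w₄ * ((x₃ - x₂) * (x₄ - x₂) * (x₄ - x₃)) ^ 2
                + w₁ * w₃ * w₄ * ((x₃ - x₁) * (x₄ - x₁) * (x₄ - x₃)) ^ 2
                + w₁ * w₂ * w₃ * ((x₂ - x₁) * (x₃ - x₁) * (x₃ - x₂)) ^ 2
            ≤ 3 * (w₁ * w₂ * w₄ * ((x₂ - x₁) * (x₄ - x₁) * (x₄ - x₂)) ^ 2)))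
    ∨ ((1/10 ≤ w₄
        ∧ w₁ * w₂ * (x₁ - x₂) ^ 2 + w₁ * w₃ * (x₁ - x₃) ^ 2 + w₂ * w₃ * (x₂ - x₃) ^ 2
            ≤ 3 * (w₁ * w₄ * (x₁ - x₄) ^ 2 + w₂ * w₄ * (x₂ - x₄) ^ 2 + w₃ * w₄ * (x₃ - x₄) ^ 2)
        ∧ w₁ * w₂ * w₃ * ((x₂ - x₁) * (x₃ - x₁) * (x₃ - x₂)) ^ 2
            ≤ 3 * (w₂ * w₃ * w₄ * ((x₃ - x₂) * (x₄ - x₂) * (x₄ - x₃)) ^ 2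
                + w₁ * w₃ * w₄ * ((x₃ - x₁) * (x₄ - x₁) * (x₄ - x₃)) ^ 2
                + w₁ * w₂ * w₄ * ((x₂ - x₁) * (x₄ - x₁) * (x₄ - x₂)) ^ 2))
      ∨ (w₄ ≤ 2/5
        ∧ w₁ * w₄ * (x₁ - x₄) ^ 2 + w₂ * w₄ * (x₂ - x₄) ^ 2 + w₃ * w₄ * (x₃ - x₄) ^ 2
            ≤ 3 * (w₁ * w₂ * (x₁ - x₂) ^ 2 + w₁ * w₃ * (x₁ - x₃) ^ 2 + w₂ * w₃ * (x₂ - x₃) ^ 2)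
        ∧ w₂ * w₃ * w₄ * ((x₃ - x₂) * (x₄ - x₂) * (x₄ - x₃)) ^ 2
                + w₁ * w₃ * w₄ * ((x₃ - x₁) * (x₄ - x₁) * (x₄ - x₃)) ^ 2
                + w₁ * w₂ * w₄ * ((x₂ - x₁) * (x₄ - x₁) * (x₄ - x₂)) ^ 2
            ≤ 3 * (w₁ * w₂ * w₃ * ((x₂ - x₁) * (x₃ - x₁) * (x₃ - x₂)) ^ 2))) := by
  rcases coverB_four x₁ x₂ x₃ x₄ w₁ w₂ w₃ w₄ hw₁ hw₂ hw₃ hw₄ hs with h | h | h | h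
  · exact Or.inl (Or.inl h)
  · exact Or.inr (Or.inl (Or.inl h))
  · exact Or.inr (Or.inr (Or.inl (Or.inl h)))
  · exact Or.inr (Or.inr (Or.inr (Or.inl h)))

end Literature.MathematicalPhysics.QuantumLattice.Imbrie2016
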